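import Mathlib
import Literature.Computability.AlgebraicComplexity.SmallFormatRankChains

/-!
# Coordinates of subset sums in a basis extending an independent block

Second plumbing lemma of the kernel plan for the type model (solo-blind programme, K3.35).
Let `B` be a finite block whose vectors `h i` are linearly independent over `ZMod 3`, and let
`β = Basis.sumExtend hli` be a basis of `G` extending it (so `β (inl i) = h i`).  Then an element
`g : G` is a subset sum `∑_{i ∈ A} h i` (`A ⊆ B`) iff its `β`-coordinates are `0/1` on the block
and `0` outside it; and then `A` is read off as the set of block coordinates equal to `1`.
This is the dictionary "representation `A_C` ↔ coordinates of type `1`" of the type model.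
Nothing here bears on `ω`.
-/

namespace Summit.MatrixMultiplication.MatrixMultiplication.Theorems

open Finset Module

variable {G : Type*} [AddCommGroup G] [Module (ZMod 3) G] {ι : Type*} [DecidableEq ι]

/-- Block coordinates of a subset sum are the indicator of `A`. -/
theorem soloBlind_coord_inl_subsetSum (h : ι → G) (B : Finset ι)
    (hli : LinearIndependent (ZMod 3) (fun i : B => h i)) (A : Finset B) (i : B) :
    (Basis.sumExtend hli).coord (Sum.inl i) (∑ j ∈ A, h (j : ι)) =
      if i ∈ A then (1 : ZMod 3) else 0 := by
  classical
  rw [map_sum]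
  have hterm : ∀ j ∈ A, (Basis.sumExtend hli).coord (Sum.inl i) (h (j : ι))
      = if j = i then (1 : ZMod 3) else 0 := by
    intro j _
    have hj : h (j : ι) = Basis.sumExtend hli (Sum.inl j) :=
      (Literature.Computability.AlgebraicComplexity.sumExtend_inl hli j).symm
    rw [hj, Basis.coord_apply, Basis.repr_self, Finsupp.single_apply]
    by_cases hji : j = i
    · subst hji; simp
    · have : ¬ (Sum.inl j : B ⊕ Basis.sumExtendIndex hli) = Sum.inl i := by
        simpa using hji
      simp [this, hji]
  rw [Finset.sum_congr rfl hterm, Finset.sum_ite_eq' A i]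

/-- Ambient coordinates of a subset sum vanish. -/
theorem soloBlind_coord_inr_subsetSum (h : ι → G) (B : Finset ι)
    (hli : LinearIndependent (ZMod 3) (fun i : B => h i)) (A : Finset B)
    (j : Basis.sumExtendIndex hli) :
    (Basis.sumExtend hli).coord (Sum.inr j) (∑ i ∈ A, h (i : ι)) = 0 := by
  classical
  rw [map_sum]
  refine Finset.sum_eq_zero fun i _ => ?_
  have hi : h (i : ι) = Basis.sumExtend hli (Sum.inl i) :=
    (Literature.Computability.AlgebraicComplexity.sumExtend_inl hli i).symm
  rw [hi, Basis.coord_apply, Basis.repr_self, Finsupp.single_apply]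
  simp

/-- Conversely: an element whose block coordinates are `0/1` and whose ambient coordinates vanish
is the subset sum over the block coordinates equal to `1`. -/
theorem soloBlind_eq_subsetSum_of_coords (h : ι → G) (B : Finset ι)
    (hli : LinearIndependent (ZMod 3) (fun i : B => h i)) (g : G)
    (h0 : ∀ j : Basis.sumExtendIndex hli, (Basis.sumExtend hli).coord (Sum.inr j) g = 0)
    (h1 : ∀ i : B, (Basis.sumExtend hli).coord (Sum.inl i) g = 0 ∨
      (Basis.sumExtend hli).coord (Sum.inl i) g = 1) :
    g = ∑ i ∈ (Finset.univ.filter fun i : B => (Basis.sumExtend hli).coord (Sum.inl i) g = 1),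
      h (i : ι) := by
  classical
  refine (Basis.sumExtend hli).ext_elem fun x => ?_
  rw [← Basis.coord_apply, ← Basis.coord_apply]
  rcases x with i | j
  · rw [soloBlind_coord_inl_subsetSum]
    simp only [Finset.mem_filter, Finset.mem_univ, true_and]
    rcases h1 i with h0i | h1i
    · rw [h0i]; simp
    · rw [h1i]; simp
  · rw [soloBlind_coord_inr_subsetSum, h0 j]

/-- The dictionary in `iff` form: `g` is a subset sum of the block iff its coordinates are `0/1`
on the block and `0` outside. -/
theorem soloBlind_subsetSum_iff_coords (h : ι → G) (B : Finset ι)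
    (hli : LinearIndependent (ZMod 3) (fun i : B => h i)) (g : G) :
    (∃ A : Finset B, ∑ i ∈ A, h (i : ι) = g) ↔
      (∀ j : Basis.sumExtendIndex hli, (Basis.sumExtend hli).coord (Sum.inr j) g = 0) ∧
      (∀ i : B, (Basis.sumExtend hli).coord (Sum.inl i) g = 0 ∨
        (Basis.sumExtend hli).coord (Sum.inl i) g = 1) := by
  classical
  constructor
  · rintro ⟨A, rfl⟩
    refine ⟨fun j => soloBlind_coord_inr_subsetSum h B hli A j, fun i => ?_⟩
    rw [soloBlind_coord_inl_subsetSum]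
    by_cases hiA : i ∈ A
    · right; simp [hiA]
    · left; simp [hiA]
  · rintro ⟨h0, h1⟩
    exact ⟨_, (soloBlind_eq_subsetSum_of_coords h B hli g h0 h1).symm⟩

end Summit.MatrixMultiplication.MatrixMultiplication.Theorems
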